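import Summits.BirchSwinnertonDyer.BirchSwinnertonDyer.Theorems.PrintCFramBottomClassIndexLawFiveLeFlipRungOfRung
import HarnessLib

/-!
# Crux `PrintCFram.BottomClassIndexLawFiveLe` (stmt-BirchSwinnertonDyer-20372), line `eisenstein-resource-bdp-line` (registry v29 `stub_flipRungs.2`):
# THE 2-ADIC FLIPPED-CUSP RUNG, layer A — (FlipRungTwo⁶) ⟸ (RungTwo⁶): THE 2-ADIC RUNG IN COHEN-NUMBER CURRENCY IMPLIES IT IN BERNOULLI CURRENCY
# (cell `bsd-print-cfram`, width seat `bsd-line-cfram-p1-w7` g8; THEOREMS ONLY, `--supports` 20372 `--as helper`; BSD is not proved by any of this)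

HONEST FRAMING. Nothing here is a statement about BSD; no registered stub is closed. Registry v29 (LEAD g14) carries
`stub_flipRungs := (FlipRungAll⁶) ∧ (FlipRungTwo⁶)`; (FlipRungTwo⁶) is the `hFlipTwo` binder of
`FlipRung.seedOffExc_of_flipRung_of_flipRungTwo_of_badOdd_cut` (p709604, this seat) VERBATIM: for a class datum `(p, m, χ, k)` of the six leaf
primes with `2 ∣ m` and a `±1` pattern `τ` on the odd primes of `m`, «field factor a non-unit at every `K₀` of pattern `τ` with `d_{K₀} ≡ 1 (mod 8)`»
implies the same at every `K₀` of pattern `τ` with `d_{K₀} ≡ 5 (mod 8)` (the 2-adic flip `d ≡ 1 ↦ d ≡ 5 (mod 8)` of the 2-adic flipped-cusp rung,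
crux notes `Lines/eisenstein-resource-bdp-line-w7g8-T6.md` §2, class `c_S = 7` read, class `c_I = 3` inferred). This file is the 2-adic twin of w8 g9's
layer A `FlipRung.flipRung_six_of_rung` (p707470): it proves **`flipRungTwo_six_of_rungTwo : (RungTwo⁶) → (FlipRungTwo⁶)`** where (RungTwo⁶) is the
same statement in COHEN-NUMBER currency — «`‖H(k, a)‖_p ≤ p⁻¹` at every index `a` of the `τ`-cut with `a/m ≡ 7 (mod 8)` ⟹ the same at every index
of the `τ`-cut with `a/m ≡ 3 (mod 8)`» — which is what the modular side of T6 (the class cuts `P_c` of Cohen's `H_k` read at the cusp `W(∞)`,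
`W = [[64a, b],[64M′, 64]]`, unit weights `w_c(n)`: T6a p-pending `…FlipRungTwoGaussSums`, T6b p710070 `…FlipRungTwoMatrixFactorisation`, T6c–e)
delivers. The proof is w8 g9's, with the 2-adic clause `a/m ≡ 7 (8)` (hypothesis side, `d_K = −n₀`, `n₀f² ≡ 7 ⟹ n₀ ≡ 7 (mod 8)` for odd `f`)
resp. `a/m ≡ 3 (8)` (conclusion side, read at the fundamental index `a = m·|d_{K₀}|`, `f = 1`) in place of `(2 ∣ m → a/m ≡ 7 (8))`, and the SAME
pattern `τ` on both sides (the 2-adic flip does not touch the odd primes).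

No definitions, no named facts, no `sorry`. beyond-print theorem: NO (dictionary / plumbing).
References: [Cohen1975] §2 (definition of `H(r, N)`), Thm. 3.1; [Washington1997] Thm. 4.2; crux notes w7g8-T6 §2, lead-g14 §2.
-/

set_option autoImplicit false
-- summit-side namespace `Summit.BirchSwinnertonDyer.BirchSwinnertonDyer.…` (single-conjunct summit, D-0017 layout)
set_option linter.dupNamespace false

noncomputable section

open scoped Classical NumberTheorySymbols
open NumberField DirichletCharacter Literature.NumberTheory.LFunctions
  Literature.NumberTheory.ModularForms.CohenEisenstein
  Literature.NumberTheory.EllipticCurves Literature.NumberTheory.EllipticCurves.KrizLi2019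
  Literature.NumberTheory.QuadraticFields

namespace Summit.BirchSwinnertonDyer.BirchSwinnertonDyer.Theorems.PrintCFram.FlipRung

/-! ## (FlipRungTwo⁶) ⟸ (RungTwo⁶) -/

/-- **THE 2-ADIC FLIPPED-CUSP RUNG IN BERNOULLI CURRENCY FROM THE 2-ADIC RUNG IN COHEN-NUMBER CURRENCY.** Hypothesis (RungTwo⁶): for every
class datum `(p, m, χ, k)` of the six leaf primes with `2 ∣ m` and every sign pattern `τ` (`±1` on the odd primes of `m`): if `‖H(k, a)‖_p ≤ p⁻¹`
at every index `a` with `m ∣ a`, `a/m ≡ 3 (mod 4)`, `J(−a/m | q') = τ(q')` at the odd primes `q' ∣ m`, `a/m ≡ 7 (mod 8)`, `3 ∤ a/m`, then the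
same holds with `a/m ≡ 3 (mod 8)` in place of `a/m ≡ 7 (mod 8)` — this is what the modular side of the 2-adic rung (T6: the class cut `P_7` of
the `τ`-cut of Cohen's `H_k` read at the cusp `W(∞)`, unit weights, Katz's q-expansion principle) delivers. Conclusion: (FlipRungTwo⁶), the
`hFlipTwo` binder of `seedOffExc_of_flipRung_of_flipRungTwo_of_badOdd_cut` VERBATIM. PROOF (w8 g9's `flipRung_six_of_rung`, 2-adic clause moved).
(⇒ hypothesis of the rung) a cut index is `a = m n₀ f²` with `n₀ ≡ 3 (4)` squarefree, `f` odd (`CohenCut.exists_eq_mul_sq_of_cut`); `a/m ≡ 7 (8)`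
forces `n₀ ≡ 7 (8)`; `K := ℚ(√−n₀)` is imaginary quadratic with `d_K = −n₀ ≡ 1 (mod 8)`, odd, `< −4`, prime to `3`, of pattern `τ`; so its
field factor is a non-unit by the Bernoulli hypothesis, and `H(k, a) = −T·(field factor)` with `T ∈ ℤ`. (⇐ conclusion) for `K₀` of pattern `τ`
with `d_{K₀} ≡ 5 (mod 8)`, `a := m·|d_{K₀}|` is an index of the `τ`-cut with `a/m = |d_{K₀}| ≡ 3 (mod 8)`, so `‖H(k, a)‖ ≤ p⁻¹` by the rung, and
at `f = 1` the field factor IS `−H(k, a)`. [cite: Cohen1975, §2 (definition of H(r, N)) and Thm. 3.1] [cite: Washington1997, Thm. 4.2] -/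
theorem flipRungTwo_six_of_rungTwo
    (hRung : ∀ (p : ℕ) [Fact p.Prime] (m : ℕ) [NeZero m] (χ : DirichletCharacter ℚ_[p] m) (k : ℕ),
      (p = 7 ∨ p = 11 ∨ p = 19 ∨ p = 43 ∨ p = 67 ∨ p = 163) →
      m.Coprime p → χ.IsPrimitive → χ.IsQuadratic → (k = (p + 1) / 4 ∨ k = (3 * p - 1) / 4) →
      2 ≤ k → k ≤ p - 2 → χ (-1) * (-1) ^ k = -1 → 2 ∣ m →
      ∀ (τ : ℕ → ℤ), (∀ q' : ℕ, q'.Prime → q' ∣ m → q' ≠ 2 → (τ q' = 1 ∨ τ q' = -1)) →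
      (∀ a : ℕ, m ∣ a → a / m % 4 = 3 →
        (∀ q' : ℕ, q'.Prime → q' ∣ m → q' ≠ 2 → jacobiSym (-((a / m : ℕ) : ℤ)) q' = τ q') →
        a / m % 8 = 7 → ¬ 3 ∣ a / m → ‖((cohenH k a : ℚ) : ℚ_[p])‖ ≤ (p : ℝ)⁻¹) →
      ∀ a : ℕ, m ∣ a → a / m % 4 = 3 →
        (∀ q' : ℕ, q'.Prime → q' ∣ m → q' ≠ 2 → jacobiSym (-((a / m : ℕ) : ℤ)) q' = τ q') →
        a / m % 8 = 3 → ¬ 3 ∣ a / m → ‖((cohenH k a : ℚ) : ℚ_[p])‖ ≤ (p : ℝ)⁻¹) :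
    ∀ (p : ℕ) [Fact p.Prime] (m : ℕ) [NeZero m] (χ : DirichletCharacter ℚ_[p] m) (k : ℕ),
      (p = 7 ∨ p = 11 ∨ p = 19 ∨ p = 43 ∨ p = 67 ∨ p = 163) →
      m.Coprime p → χ.IsPrimitive → χ.IsQuadratic → (k = (p + 1) / 4 ∨ k = (3 * p - 1) / 4) →
      2 ≤ k → k ≤ p - 2 → χ (-1) * (-1) ^ k = -1 → 2 ∣ m →
      ∀ (τ : ℕ → ℤ), (∀ q' : ℕ, q'.Prime → q' ∣ m → q' ≠ 2 → (τ q' = 1 ∨ τ q' = -1)) →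
      (∀ (K₀ : Type) [Field K₀] [NumberField K₀] (ε₀ : DirichletCharacter ℚ_[p] (NumberField.discr K₀).natAbs),
        IsImaginaryQuadratic K₀ → Odd (NumberField.discr K₀) → NumberField.discr K₀ < -4 →
        ¬ ((3 : ℤ) ∣ NumberField.discr K₀) →
        (∀ q' : ℕ, q'.Prime → q' ∣ m → q' ≠ 2 → jacobiSym (NumberField.discr K₀) q' = τ q') →
        NumberField.discr K₀ % 8 = 1 → IsKroneckerCharacterOf K₀ ε₀ →
        ‖(k : ℚ_[p])⁻¹ * @generalizedBernoulli ℚ_[p] _ _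
            (changeLevel (dvd_mul_right m (NumberField.discr K₀).natAbs) χ *
              changeLevel (dvd_mul_left (NumberField.discr K₀).natAbs m) ε₀).conductor ⟨conductor_ne_zero _⟩ k
            (changeLevel (dvd_mul_right m (NumberField.discr K₀).natAbs) χ *
              changeLevel (dvd_mul_left (NumberField.discr K₀).natAbs m) ε₀).primitiveCharacter‖ ≤ (p : ℝ)⁻¹) →
      ∀ (K₀ : Type) [Field K₀] [NumberField K₀] (ε₀ : DirichletCharacter ℚ_[p] (NumberField.discr K₀).natAbs),
        IsImaginaryQuadratic K₀ → Odd (NumberField.discr K₀) → NumberField.discr K₀ < -4 →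
        ¬ ((3 : ℤ) ∣ NumberField.discr K₀) →
        (∀ q' : ℕ, q'.Prime → q' ∣ m → q' ≠ 2 → jacobiSym (NumberField.discr K₀) q' = τ q') →
        NumberField.discr K₀ % 8 = 5 → IsKroneckerCharacterOf K₀ ε₀ →
        ‖(k : ℚ_[p])⁻¹ * @generalizedBernoulli ℚ_[p] _ _
            (changeLevel (dvd_mul_right m (NumberField.discr K₀).natAbs) χ *
              changeLevel (dvd_mul_left (NumberField.discr K₀).natAbs m) ε₀).conductor ⟨conductor_ne_zero _⟩ k
            (changeLevel (dvd_mul_right m (NumberField.discr K₀).natAbs) χ *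
              changeLevel (dvd_mul_left (NumberField.discr K₀).natAbs m) ε₀).primitiveCharacter‖ ≤ (p : ℝ)⁻¹ := by
  intro p _ m _ χ k hp6 hmp hχ hχq hk hk2 hkp hpar h2m τ hτ hHyp K₀ _ _ ε₀ hK hodd hlt h3 hpat h85 hε
  have hm0 : 0 < m := Nat.pos_of_ne_zero (NeZero.ne m)
  -- Step 1: the hypothesis of the 2-adic rung on the `τ`-cut, class `a/m ≡ 7 (8)`, from the Bernoulli hypothesis through the dictionary
  have hcut : ∀ a : ℕ, m ∣ a → a / m % 4 = 3 →
      (∀ q' : ℕ, q'.Prime → q' ∣ m → q' ≠ 2 → jacobiSym (-((a / m : ℕ) : ℤ)) q' = τ q') →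
      a / m % 8 = 7 → ¬ 3 ∣ a / m → ‖((cohenH k a : ℚ) : ℚ_[p])‖ ≤ (p : ℝ)⁻¹ := by
    intro a hma ha4 hJ h8a h3a
    obtain ⟨n₀, f, hsq, hn4, hf, rfl, hdiv⟩ := CohenCut.exists_eq_mul_sq_of_cut hma ha4
    rw [hdiv] at hJ h8a h3a
    obtain ⟨-, -, hn8⟩ := ThetaCycle.mod_four_of_sq_mul (f := f) (n₁ := n₀) (by rw [mul_comm, ← hdiv]; exact ha4)
    have hn87 : n₀ % 8 = 7 := hn8 (by rw [mul_comm]; exact h8a)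
    have hn3 : ¬ 3 ∣ n₀ := fun h => h3a (dvd_mul_of_dvd_left h _)
    have hn7 : 4 < n₀ := by omega
    -- the field `K = ℚ(√−n₀)` and its Kronecker character
    have hsqZ : Squarefree (-(n₀ : ℤ)) := by
      rw [← Int.squarefree_natAbs, Int.natAbs_neg, Int.natAbs_natCast]; exact hsq
    obtain ⟨K, iF, iN, h2, hd⟩ := Quadratic.exists_numberField_discr_eq (D := -(n₀ : ℤ))
      (Or.inl ⟨by omega, hsqZ, by omega⟩)
    have hKim : IsImaginaryQuadratic K := isImaginaryQuadratic_of_discr_eq_of_neg h2 hd (by omega)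
    obtain ⟨εK, hεK, -⟩ :=
      KrizLiBinders.exists_isKroneckerCharacterOf_of_discr (p := p) h2 (m := n₀) hsq (Or.inr ⟨hd, hn4⟩)
    -- the Bernoulli hypothesis at `(K, ε_K)` (`d_K = −n₀ ≡ 1 (mod 8)`)
    have hB := hHyp K εK hKim (by rw [hd, Int.odd_iff]; omega) (by rw [hd]; omega)
      (by rw [hd, Int.dvd_neg]; exact_mod_cast hn3)
      (fun q' hq' hq'm hq'2 => by rw [hd]; exact jacobiSym_neg_eq_of_neg_mul_sq (hτ q' hq' hq'm hq'2) (hJ q' hq' hq'm hq'2))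
      (by rw [hd]; omega) hεK
    -- the dictionary
    exact norm_ratCast_cohenH_cut_le_of_norm_bernoulli_le hχ hχq hpar hsq hn4 hf (coprime_of_cut_sign hn4 hτ hJ) hKim hd hεK hB
  -- Step 2: the 2-adic rung, then read its conclusion at the fundamental index `a = m·|d_K₀|` (class `a/m ≡ 3 (8)`)
  have hflip := hRung p m χ k hp6 hmp hχ hχq hk hk2 hkp hpar h2m τ hτ hcut
  -- `d_K₀ = −n₀`, `n₀ ≡ 3 (4)` squarefree, prime to `3`, `n₀ ≡ 3 (8)`
  rcases Quadratic.isFundamentalDiscriminant_discr (K := K₀) hK.1 with ⟨hd4, hsqd, -⟩ | ⟨hd4, -, -⟩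
  swap
  · exfalso
    rw [Int.odd_iff] at hodd
    omega
  obtain ⟨n₀, hn₀⟩ : ∃ n₀ : ℕ, NumberField.discr K₀ = -(n₀ : ℤ) :=
    ⟨(NumberField.discr K₀).natAbs, by rw [Int.ofNat_natAbs_of_nonpos (by omega)]; ring⟩
  have hn4 : n₀ % 4 = 3 := by omega
  have hn83 : n₀ % 8 = 3 := by omega
  have hsq : Squarefree n₀ := by
    have h := Int.squarefree_natAbs.mpr hsqd
    rwa [hn₀, Int.natAbs_neg, Int.natAbs_natCast] at h
  have hn3 : ¬ 3 ∣ n₀ := fun h => h3 (by rw [hn₀, Int.dvd_neg]; exact_mod_cast h)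
  have hdiv : m * (n₀ * 1 ^ 2) / m = n₀ := by rw [one_pow, mul_one, Nat.mul_div_cancel_left _ hm0]
  have hJ' : ∀ q' : ℕ, q'.Prime → q' ∣ m → q' ≠ 2 → jacobiSym (-((n₀ * 1 ^ 2 : ℕ) : ℤ)) q' = τ q' := by
    intro q' hq' hq'm hq'2
    rw [show (-((n₀ * 1 ^ 2 : ℕ) : ℤ)) = NumberField.discr K₀ by rw [hn₀]; push_cast; ring]
    exact hpat q' hq' hq'm hq'2
  have hHa := hflip (m * (n₀ * 1 ^ 2)) (dvd_mul_right _ _) (by rw [hdiv]; exact hn4)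
    (fun q' hq' hq'm hq'2 => by
      rw [hdiv, ← hn₀]
      exact hpat q' hq' hq'm hq'2)
    (by rw [hdiv]; exact hn83) (by rw [hdiv]; exact hn3)
  have hcop : m.Coprime n₀ := coprime_of_cut_sign (f := 1) hn4 hτ hJ'
  rw [norm_bernoulli_eq_norm_ratCast_cohenH hχ hχq hpar hsq hn4 hcop hK hn₀ hε]
  simpa using hHa

end Summit.BirchSwinnertonDyer.BirchSwinnertonDyer.Theorems.PrintCFram.FlipRung

end
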